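import Mathlib
import Literature.MathematicalPhysics.QuantumLattice.KohnLuttinger
import Summits.HubbardSuperconductivity.HubbardSuperconductivity.Theorems.ChiralWindowCwChannelInfContinuousFilling
import HarnessLib

/-!
# Route KLProgramme — support item R0′ `H10RungCompactBox`, helper 4/4: an a-priori window for the
free-band chemical potential `μ(n)`

`chemicalPotentialOfDensity ε n = sInf {μ | n ≤ filling ε μ}` (`KohnLuttinger.lean`). For the square-lattice
band `ε(k) = -2(cos k₀ + cos k₁)` the filling vanishes below the band bottom (`μ ≤ -4`: the Fermi sea is
empty) and equals `2` above the band top (at `μ = 5` the whole Brillouin zone `[-π, π)²`, of volume `(2π)²`,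
is occupied), so for every density `0 < n ≤ 2` the chemical potential lies in the compact window `[-4, 5]`
(`h10rung_chemicalPotential_mem_Icc`; the lower half reuses `filling_of_le_neg_four` of
`ChiralWindowCwChannelInfContinuousFilling`). This places `μ(1 - δ)` of the rung `H10RungCompactBox` in a compact
box WITHOUT the finer support item `MuOfDopingWindow` (which locates it in `[-1, -0.15]`).
-/

noncomputable section

-- the tree's namespace `Summit.<Summit>.<Problem>.Theorems` repeats the summit name by design (D-0017)
set_option linter.dupNamespace false

open MeasureTheory Set Real
open Literature.MathematicalPhysics.QuantumLattice

namespace Summit.HubbardSuperconductivity.HubbardSuperconductivity.Theorems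

/-- **The volume of the Brillouin zone** `[-π, π)² ⊂ ℝ²` is `(2π)²`. -/
theorem h10rung_volume_real_brillouinZone : volume.real brillouinZone = (2 * π) ^ 2 := by
  have hpre : brillouinZone = (WithLp.ofLp : Momentum → (Fin 2 → ℝ)) ⁻¹'
      (Set.pi univ fun _ : Fin 2 => Ico (-π) π) := by
    ext k
    simp only [brillouinZone, Set.mem_setOf_eq, Set.mem_preimage, Set.mem_pi, Set.mem_univ, forall_const]
  have hvol : volume brillouinZone = ENNReal.ofReal ((2 * π) ^ 2) := by
    rw [hpre, (PiLp.volume_preserving_ofLp (Fin 2)).measure_preimage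
      (MeasurableSet.univ_pi fun _ => measurableSet_Ico).nullMeasurableSet, Real.volume_pi_Ico]
    simp only [Finset.prod_const, Finset.card_univ, Fintype.card_fin, sub_neg_eq_add]
    rw [← ENNReal.ofReal_pow (by positivity)]
    ring_nf
  rw [measureReal_def, hvol, ENNReal.toReal_ofReal (by positivity)]

/-- **Above the band top the whole zone is occupied**: `filling(5) = 2`. -/
theorem h10rung_filling_five : KohnLuttinger.filling (squareDispersion 1 0) 5 = 2 := by
  have hocc : ∀ p, fermiOccupation (squareDispersion 1 0) 5 p = 1 := fun p => by
    unfold fermiOccupation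
    rw [if_pos]
    have := squareDispersion_le_four p
    linarith
  unfold KohnLuttinger.filling
  simp_rw [hocc]
  rw [setIntegral_const, h10rung_volume_real_brillouinZone, smul_eq_mul, mul_one]
  have hπ : (π : ℝ) ≠ 0 := Real.pi_ne_zero
  field_simp

/-- **A-priori window for the free-band chemical potential**: for every density `0 < n ≤ 2`,
`μ(n) = sInf {μ | n ≤ filling(μ)} ∈ [-4, 5]`. -/
theorem h10rung_chemicalPotential_mem_Icc {n : ℝ} (hn : 0 < n) (hn2 : n ≤ 2) :
    chemicalPotentialOfDensity (squareDispersion 1 0) n ∈ Icc (-4 : ℝ) 5 := by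
  unfold chemicalPotentialOfDensity
  set S : Set ℝ := {μ | n ≤ KohnLuttinger.filling (squareDispersion 1 0) μ} with hS
  have h5 : (5 : ℝ) ∈ S := by
    show n ≤ KohnLuttinger.filling (squareDispersion 1 0) 5
    rw [h10rung_filling_five]; exact hn2
  have hlow : ∀ μ ∈ S, (-4 : ℝ) ≤ μ := by
    intro μ hμ
    by_contra hlt
    push Not at hlt
    have h0 := filling_of_le_neg_four hlt.le
    have : n ≤ KohnLuttinger.filling (squareDispersion 1 0) μ := hμ
    rw [h0] at this
    linarith
  exact ⟨le_csInf ⟨5, h5⟩ hlow, csInf_le ⟨-4, hlow⟩ h5⟩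

end Summit.HubbardSuperconductivity.HubbardSuperconductivity.Theorems

end
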